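/-
Copyright: statement-level skeleton of a published paper (lit-balaban cell, reader/typer r15). No proof claims beyond
what the kernel checks below.
-/
import Literature.MathematicalPhysics.QuantumFieldTheory.BalabanImbrieJaffe1984to88.BIJ85Sect1Model

/-!
# BIJ85 — T. Bałaban, J. Imbrie, A. Jaffe, *Renormalization of the Higgs model: minimizers, propagators and the
stability of mean field theory*, CMP **97** (1985) 299–329, Sect. 2 (2.28)–(2.29): the ε-lattice action and its scaling
to the unit lattice

statement-level skeleton of published theorems with citation tags; proofs where landed; nothing here is a claim about
the Yang–Mills mass gap

Source: held text `paper:balaban1985-cmp97-bij-higgs-minimizers`; render of p. 305 read as an image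
(`HOME/lit-balaban-r15/pages/1985-cmp97-bij-higgs-minimizers-p007-x2.png`).  Row C1.Eq2.28-2.29 of
`HOME/lit-balaban-r15/ROWS-C1.md`.  Builds on `BIJ85Sect1Model` ((1.1)–(1.2): `action`, `eEps`, `lamEps`, `selfInt`).

* **(2.28)** p. 305 [PDF 7], verbatim: *"Then the ε-lattice action S_ε = Σ_{p∈T_ε} e^{−2}ε^{d−4}(1 − Re u(p)) + ½Σ_{b∈T_ε}
  ε^d|D_uφ|² + Σ_{x∈T_ε} ε^dP_ε(φ_x) + E, (2.28) where P_ε(ξ) = λ|ξ|⁴ − ¼(m² + δm²)|ξ|²"* — `selfIntEps`, `actionEps` (defs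
  with bodies; the ε-lattice covariant derivative carries the factor ε^{−1}, (D^ε_uφ)_b = ε^{−1}(u_bφ_{b₊} − φ_{b₋}), as in
  (I.1.7) of [3] = `…Balaban1983to89.B1` — with the bare difference the kinetic term would scale with ε^d instead of ε^{d−2};
  reading recorded, T-note in the row).
* **(2.29)** *"is related to the unit lattice action (1.1) by S_ε = S(𝒮_εφ, 𝒮_εu). (2.29)"* with the canonical scaling (2.25)
  (𝒮_εφ)_x = ε^{(d−2)/2}φ_x, 𝒮_εu = u and the couplings of (1.1)–(1.2): e(ε) = eε^{(4−d)/2}, λ(ε) = λε^{4−d}, the mass term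
  ¼(m² + δm²)ε² — PROVED term by term (`actionEps_eq_action`), for ε > 0, in every dimension d.

v1.1 (append-only, reader/typer r15 gen 2; row C1.Eq2.25-2.27): the scale transformation 𝒮_{L^{−1}} of p. 305 itself —
* **(2.25)** *"(𝒮_{L^{−1}}φ)_x = L^{−(d−2)/2}φ_{Lx}"* — `scaleL` (def with body; the L-lattice site Lx and the unit-lattice site x
  carry one label of `Site P j`, so 𝒮_{L^{−1}} is the multiplication by L^{−(d−2)/2}); `scaleL_eq_scaleField`: it is `scaleField`
  at ε = L^{−1} (PROVED, L ≥ 0).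
* **(2.26)** *"(𝒮_{L^{−1}}f)_p = L^{d/2}f_{Lp}"* for plaquette fields — `scaleLPlaq` (def with body, values in any real vector space).
* **(2.27)** *"so for a quadratic form σ, Σ_{p∈T_L} L^d⟨f_p, σf_p⟩ = Σ_{p∈T_1} ⟨(𝒮_{L^{−1}}f)_p, σ(𝒮_{L^{−1}}f)_p⟩"* — `eq227`, PROVED
  for every real linear σ on a real inner-product space and L ≥ 0 (termwise: ⟨L^{d/2}v, σ(L^{d/2}v)⟩ = L^d⟨v, σv⟩).
-/

open scoped BigOperators

namespace Literature.MathematicalPhysics.QuantumFieldTheory.BalabanImbrieJaffe1984to88.BIJ85Sect2Scaling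

noncomputable section

open Literature.MathematicalPhysics.QuantumFieldTheory.Balaban1983to89
open BIJ85Sect1Model

variable {P : Params} {j : ℕ}

/-- **(2.28)** *"P_ε(ξ) = λ|ξ|⁴ − ¼(m² + δm²)|ξ|²"* (`msq` = m² + δm²). [cite: BalabanImbrieJaffe1985, (2.28) p.305] -/
def selfIntEps (lam msq : ℝ) (ξ : ℂ) : ℝ := lam * ‖ξ‖ ^ 4 - (1 / 4) * msq * ‖ξ‖ ^ 2

/-- **(2.28)** p. 305 [PDF 7]: *"S_ε = Σ_{p∈T_ε} e^{−2}ε^{d−4}(1 − Re u(p)) + ½Σ_{b∈T_ε} ε^d|D_uφ|² + Σ_{x∈T_ε} ε^dP_ε(φ_x) + E"*,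
with the ε-lattice covariant derivative (D^ε_uφ)_b = ε^{−1}(u_bφ_{b₊} − φ_{b₋}) (`covDeriv`/ε); the weights ε^{d−4}, ε^d as real
powers `ε ^ ((d:ℝ) − 4)`, `ε ^ (d:ℝ)`. [cite: BalabanImbrieJaffe1985, (2.28) p.305] -/
def actionEps (ε e lam msq E : ℝ) (u : U1Field P j) (φ : HiggsField P j) : ℝ :=
  (∑ p : Plaq P j, e⁻¹ ^ 2 * ε ^ ((P.d : ℝ) - 4) * (1 - ((plaq u p : Circle) : ℂ).re)) +
    (1 / 2) * (∑ b : PBond P j, ε ^ (P.d : ℝ) * ‖ε⁻¹ • covDeriv u φ b‖ ^ 2) +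
    (∑ x : Site P j, ε ^ (P.d : ℝ) * selfIntEps lam msq (φ x)) + E

/-- **(2.25)** pattern for the passage ε-lattice → unit lattice: *"The canonical scaling for scalar fields
(𝒮_{L^{−1}}φ)_x = L^{−(d−2)/2}φ_{Lx}. (2.25)"* — here (𝒮_εφ)_x = ε^{(d−2)/2}φ_x (sites identified), 𝒮_εu = u.
[cite: BalabanImbrieJaffe1985, (2.25) p.305] -/
def scaleField (ε : ℝ) (φ : HiggsField P j) : HiggsField P j := fun x => ((ε ^ (((P.d : ℝ) - 2) / 2) : ℝ) : ℂ) * φ x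

/-- kernel: the covariant derivative is linear in the scalar field under the scaling. [cite: BalabanImbrieJaffe1985, (2.29) p.305] -/
theorem covDeriv_scaleField (ε : ℝ) (u : U1Field P j) (φ : HiggsField P j) (b : PBond P j) :
    covDeriv u (scaleField ε φ) b = ((ε ^ (((P.d : ℝ) - 2) / 2) : ℝ) : ℂ) * covDeriv u φ b := by
  simp only [covDeriv, scaleField]
  ring

/-- **(2.29)** p. 305 [PDF 7], verbatim: *"where P_ε(ξ) = λ|ξ|⁴ − ¼(m² + δm²)|ξ|² is related to the unit lattice action (1.1) by
S_ε = S(𝒮_εφ, 𝒮_εu). (2.29)"* — PROVED: with e(ε) = eε^{(4−d)/2}, λ(ε) = λε^{4−d}, mass term ¼(m² + δm²)ε² (the couplings of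
(1.1)–(1.2)) and the canonical scaling `scaleField`, for ε > 0 (any e: Lean's 0⁻¹ = 0 makes e = 0 harmless). [cite: BalabanImbrieJaffe1985, (2.29) p.305] -/
theorem actionEps_eq_action (ε e lam msq E : ℝ) (hε : 0 < ε) (u : U1Field P j) (φ : HiggsField P j) :
    actionEps ε e lam msq E u φ = action (eEps e ε P.d) (lamEps lam ε P.d) (msq * ε ^ 2) E u (scaleField ε φ) := by
  have hε0 : ε ≠ 0 := hε.ne'
  set s : ℝ := ε ^ (((P.d : ℝ) - 2) / 2) with hs
  have hs0 : 0 < s := Real.rpow_pos_of_pos hε _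
  -- the three termwise scaling identities
  have hgauge : (eEps e ε P.d)⁻¹ ^ 2 = e⁻¹ ^ 2 * ε ^ ((P.d : ℝ) - 4) := by
    unfold eEps
    have h1 : (ε ^ ((4 - (P.d : ℝ)) / 2))⁻¹ ^ 2 = ε ^ ((P.d : ℝ) - 4) := by
      rw [← Real.rpow_neg hε.le, ← Real.rpow_natCast, ← Real.rpow_mul hε.le]
      congr 1
      push_cast
      ring
    rw [mul_inv, mul_pow, h1]
  have hkin : ∀ b : PBond P j,
      ‖covDeriv u (scaleField ε φ) b‖ ^ 2 = ε ^ (P.d : ℝ) * ‖ε⁻¹ • covDeriv u φ b‖ ^ 2 := by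
    intro b
    rw [covDeriv_scaleField, norm_mul, norm_smul, Complex.norm_real, Real.norm_of_nonneg hs0.le, norm_inv,
      Real.norm_of_nonneg hε.le, mul_pow, mul_pow]
    have h2 : s ^ 2 = ε ^ (P.d : ℝ) * ε⁻¹ ^ 2 := by
      rw [hs, ← Real.rpow_natCast, ← Real.rpow_mul hε.le, inv_pow, ← Real.rpow_natCast ε 2, ← Real.rpow_neg hε.le,
        ← Real.rpow_add hε]
      congr 1
      push_cast
      ring
    rw [h2]
    ring
  have hpot : ∀ x : Site P j,
      selfInt (lamEps lam ε P.d) (msq * ε ^ 2) (scaleField ε φ x) = ε ^ (P.d : ℝ) * selfIntEps lam msq (φ x) := by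
    intro x
    simp only [selfInt, selfIntEps, scaleField, lamEps, norm_mul, Complex.norm_real, mul_pow]
    rw [← hs, Real.norm_of_nonneg hs0.le]
    have h4 : ε ^ (4 - (P.d : ℝ)) * s ^ 4 = ε ^ (P.d : ℝ) := by
      rw [hs, ← Real.rpow_natCast, ← Real.rpow_mul hε.le, ← Real.rpow_add hε]
      congr 1
      push_cast
      ring
    have h2 : ε ^ 2 * s ^ 2 = ε ^ (P.d : ℝ) := by
      rw [hs, ← Real.rpow_natCast (ε ^ _), ← Real.rpow_mul hε.le, ← Real.rpow_natCast ε 2, ← Real.rpow_add hε]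
      congr 1
      push_cast
      ring
    calc lam * ε ^ (4 - (P.d : ℝ)) * (s ^ 4 * ‖φ x‖ ^ 4) - 1 / 4 * (msq * ε ^ 2) * (s ^ 2 * ‖φ x‖ ^ 2)
        = lam * (ε ^ (4 - (P.d : ℝ)) * s ^ 4) * ‖φ x‖ ^ 4 - 1 / 4 * msq * (ε ^ 2 * s ^ 2) * ‖φ x‖ ^ 2 := by ring
      _ = ε ^ (P.d : ℝ) * (lam * ‖φ x‖ ^ 4 - 1 / 4 * msq * ‖φ x‖ ^ 2) := by rw [h4, h2]; ring
  unfold actionEps action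
  simp only [hgauge, hkin, hpot]

/-! ## v1.1 (append-only): (2.25)–(2.27) — the scale transformation 𝒮_{L^{−1}}, p. 305 [PDF 7] -/

/-- **(2.25)** p. 305 [PDF 7], verbatim: *"Finally we consider a scale transformation 𝒮_{L^{−1}} which maps L-lattice fields to
unit lattice fields. The canonical scaling for scalar fields (𝒮_{L^{−1}}φ)_x = L^{−(d−2)/2}φ_{Lx}. (2.25)"* — the L-lattice site
Lx and the unit-lattice site x carry the same label (`Site P j`), so 𝒮_{L^{−1}} is the multiplication by the real constant
L^{−(d−2)/2} (a real power; L = the block size of the paper, any real here). [cite: BalabanImbrieJaffe1985, (2.25) p.305] -/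
def scaleL (L : ℝ) (φ : HiggsField P j) : HiggsField P j := fun x => ((L ^ (-(((P.d : ℝ) - 2) / 2)) : ℝ) : ℂ) * φ x

/-- kernel: (2.25) is the scaling `scaleField` of (2.29) at ε = L^{−1}: L^{−(d−2)/2} = (L^{−1})^{(d−2)/2} for L ≥ 0.
[cite: BalabanImbrieJaffe1985, (2.25) p.305] -/
theorem scaleL_eq_scaleField (L : ℝ) (hL : 0 ≤ L) (φ : HiggsField P j) : scaleL L φ = scaleField L⁻¹ φ := by
  funext x
  simp only [scaleL, scaleField, Real.rpow_neg hL, Real.inv_rpow hL]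

/-- **(2.26)** p. 305 [PDF 7], verbatim: *"For gauge fields, the L-lattice action Σ_p L^d⟨f_p, σf_p⟩ can be written in terms of
a unit lattice action with (𝒮_{L^{−1}}f)_p = L^{d/2}f_{Lp}, (2.26)"* — plaquette fields with values in a real vector space `V`,
the L-lattice plaquette Lp and the unit-lattice plaquette p carrying the same label (`Plaq P j`).
[cite: BalabanImbrieJaffe1985, (2.26) p.305] -/
def scaleLPlaq {V : Type*} [AddCommGroup V] [Module ℝ V] (L : ℝ) (f : Plaq P j → V) : Plaq P j → V :=
  fun p => (L ^ ((P.d : ℝ) / 2)) • f p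

open scoped RealInnerProductSpace in
/-- **(2.27)** p. 305 [PDF 7], verbatim: *"so for a quadratic form σ, Σ_{p∈T_L} L^d⟨f_p, σf_p⟩ =
Σ_{p∈T_1} ⟨(𝒮_{L^{−1}}f)_p, σ(𝒮_{L^{−1}}f)_p⟩. (2.27)"* — PROVED for every real-linear σ on a real inner-product space `V`
and every L ≥ 0, termwise: ⟨L^{d/2}v, σ(L^{d/2}v)⟩ = (L^{d/2})²⟨v, σv⟩ = L^d⟨v, σv⟩. [cite: BalabanImbrieJaffe1985, (2.27) p.305] -/
theorem eq227 {V : Type*} [NormedAddCommGroup V] [InnerProductSpace ℝ V] (L : ℝ) (hL : 0 ≤ L) (σ : V →ₗ[ℝ] V)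
    (f : Plaq P j → V) :
    ∑ p : Plaq P j, L ^ P.d * ⟪f p, σ (f p)⟫ = ∑ p : Plaq P j, ⟪scaleLPlaq L f p, σ (scaleLPlaq L f p)⟫ := by
  have h : L ^ ((P.d : ℝ) / 2) * L ^ ((P.d : ℝ) / 2) = L ^ P.d := by
    rw [← sq, ← Real.rpow_natCast (L ^ ((P.d : ℝ) / 2)) 2, ← Real.rpow_mul hL, ← Real.rpow_natCast L P.d]
    congr 1
    push_cast
    ring
  refine Finset.sum_congr rfl fun p _ => ?_
  simp only [scaleLPlaq, map_smul, real_inner_smul_left, real_inner_smul_right, ← h]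
  ring

end

end Literature.MathematicalPhysics.QuantumFieldTheory.BalabanImbrieJaffe1984to88.BIJ85Sect2Scaling
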